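import Literature.AlgebraicGeometry.Frobenioids.ArchimedeanAngloidAnchorsR
import Literature.AlgebraicGeometry.Frobenioids.ArchimedeanAngularLength
import Literature.AlgebraicGeometry.Frobenioids.ArchimedeanSlitTools
import Literature.AlgebraicGeometry.Frobenioids.ArchimedeanFSMIrreducible
import Literature.AlgebraicGeometry.Frobenioids.ArchimedeanIsotropy
import Literature.AlgebraicGeometry.Frobenioids.ArchimedeanRegionCalculus
import Literature.AlgebraicGeometry.Frobenioids.CircleOpensProofs5
import Mathlib.Topology.Homeomorph.Lemmas
import HarnessLib

/-!
# Frobenioids II, Proposition 3.5 (iii) for `R`: the Lemma 3.2 input — irreducible arrows of the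
# rigidified angloid `R₀` out of a complex object (proof-only)

Mochizuki, *The geometry of Frobenioids II: poly-Frobenioids*, Kyushu J. Math. **62** (2008) 401–460,
§3, Lemma 3.2 (vii) p. 26 and the proof of Proposition 3.5 (ii)/(iii), p. 35 ll. 22–40
[cite: MochizukiFrdII2008, Prop 3.5 (iii) p.34]: "… the finiteness of the collection of isomorphism
classes of `^C G` arising from `φ` which are isometric pre-steps follows immediately from Lemma 3.2,
(iii), (vii)".

PROVED here, for the absolute rigidified angloid `R₀ = (N₀)_{[ℝ-unit]}` ([FrdII] Ex. 3.3 (iv)):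
* `exists_between_of_ne_of_ne_univ` — [FrdII] Lem. 3.2 (vii) (`CircleOpens.ItemVII_holds`, seat
  abc-iut-L1-t7) transported from `S¹` to the tree's `O_ℂ^×` along the homeomorphism `ucHomeo`:
  strictly between two nested connected opens `A ⊊ B ≠ O_ℂ^×` lies a third;
* `C0.exists_fac_of_not_isotropic` — a linear isometry `ψ : P → Q` of `C₀` between complex objects that
  is not an isomorphism and whose codomain is NOT isotropic factors as `ψ = m₁ ≫ m₂` through a complex
  object with `m₁`, `m₂` linear isometries, neither invertible (the intermediate angular part given by
  Lem. 3.2 (vii));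
* `R0.isNaivelyIsotropic_of_irreducible` — hence an IRREDUCIBLE arrow of `R₀` with complex codomain
  has (naively) isotropic codomain ("the isotropic hull", slit morphisms, Ex. 3.3 (v));
* `R0.exists_iso_of_isotropic` / **`R0.exists_iso_of_irreducible`** — any two irreducible arrows of
  `R₀` out of the same object with complex codomains are isomorphic under it (the rigidifications
  force the comparison isomorphism, `N₀` being totally epimorphic);
* **`R.isRCAnchor_of_isRCAnchor_base`** — the hypothesis `hB` of `R.isRCAnchor_of_isRCAnchor_snd`
  (`ArchimedeanAngloidAnchorsR.lean`) discharged: an object of `R = R₀ ×_{D₀} D` over an RC-anchor of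
  `D` is an RC-anchor of `R`, for EVERY base `π : D → D₀`.

No definitions; no statement of the paper is re-typed; nothing here bears on [IUTchIII] Cor. 3.12.
Seat abc-iut-w4-d027 (gen 2), sub-DAG row P35-L06.
-/

namespace Literature.AlgebraicGeometry.Frobenioids

open CategoryTheory
open scoped Pointwise

noncomputable section

namespace ArchFrd

universe v u

/-! ### Lemma 3.2 (vii) on `O_ℂ^×` -/

/-- **[FrdII] Lem. 3.2 (vii) transported to `O_ℂ^×`**: if `A ⊊ B` are [nonempty] connected open
subsets of `O_ℂ^×` with `B ≠ O_ℂ^×`, there is a connected open `C` with `A ⊊ C ⊊ B`.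
[cite: MochizukiFrdII2008, Lem 3.2 (vii) p.26] -/
theorem exists_between_of_ne_of_ne_univ {A B : Set ↥(normOneSubgroup ℂ)} (hA : IsConnected A)
    (hAo : IsOpen A) (hB : IsConnected B) (hBo : IsOpen B) (hAB : A ⊆ B) (hne : A ≠ B)
    (hBu : B ≠ Set.univ) :
    ∃ C : Set ↥(normOneSubgroup ℂ), IsConnected C ∧ IsOpen C ∧ A ⊆ C ∧ C ⊆ B ∧ C ≠ A ∧ C ≠ B := by
  let e := ucHomeo
  have hinj : Function.Injective (Set.preimage e) := e.surjective.preimage_injective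
  have hS : CircleOpens.Setting (e ⁻¹' A) (e ⁻¹' B) :=
    ⟨e.isConnected_preimage.mpr hA, e.isOpen_preimage.mpr hAo, e.isConnected_preimage.mpr hB,
      e.isOpen_preimage.mpr hBo, Set.preimage_mono hAB⟩
  have hne' : e ⁻¹' A ≠ e ⁻¹' B := fun h => hne (hinj h)
  have hBu' : e ⁻¹' B ≠ Set.univ := fun h => hBu (hinj (by rw [h, Set.preimage_univ]))
  obtain ⟨C, ⟨hC, hCo, hAC, hCB⟩, ⟨-, hAC', -, -⟩, ⟨-, hCB', -, -⟩⟩ :=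
    CircleOpens.ItemVII_holds _ _ hS hne' hBu'
  refine ⟨e '' C, e.isConnected_image.mpr hC, e.isOpen_image.mpr hCo, ?_, ?_, ?_, ?_⟩
  · intro x hx
    exact ⟨e.symm x, hAC (by simpa using hx), e.apply_symm_apply x⟩
  · rintro _ ⟨y, hy, rfl⟩
    exact hCB hy
  · intro h
    apply hAC'
    rw [← h, e.preimage_image]
  · intro h
    apply hCB'
    rw [← h, e.preimage_image]

/-! ### Regions: equality of angular parts and tips gives an isomorphism -/

/-- If `(c/|c|) · B_P = B'` and `|c| · λ_P = λ'`, then `c · A_P = A'` (polar coordinates).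
[cite: MochizukiFrdII2008, Def 3.1 (iii) p.24] -/
theorem AngularRegion.smul_carrier_eq_of_dir_eq (A A' : AngularRegion ℂ) (c : ℂˣ)
    (hdir : unitPart ℂ c • A.dir = A'.dir) (htip : absHom ℂ c * A.tip = A'.tip) :
    c • A.carrier = A'.carrier := by
  ext v
  constructor
  · rintro ⟨u, hu, rfl⟩
    rw [AngularRegion.mem_carrier_polar_iff] at hu
    show c * u ∈ A'.carrier
    rw [AngularRegion.mem_carrier_polar_iff]
    refine ⟨?_, ?_⟩
    · rw [unitPart_mul, ← hdir]
      exact Set.smul_mem_smul_set hu.1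
    · rw [map_mul, ← htip]
      exact mul_le_mul_right hu.2 _
  · intro hv
    rw [AngularRegion.mem_carrier_polar_iff] at hv
    refine ⟨c⁻¹ * v, ?_, show c * (c⁻¹ * v) = v from mul_inv_cancel_left c v⟩
    rw [AngularRegion.mem_carrier_polar_iff]
    refine ⟨?_, ?_⟩
    · rw [unitPart_mul, unitPart_inv, ← smul_eq_mul, ← Set.mem_smul_set_iff_inv_smul_mem, hdir]
      exact hv.1
    · rw [map_mul, map_inv]
      calc (absHom ℂ c)⁻¹ * absHom ℂ v ≤ (absHom ℂ c)⁻¹ * A'.tip := mul_le_mul_right hv.2 _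
        _ = A.tip := by rw [← htip, inv_mul_cancel_left]

namespace C0

variable {P Q : C0}

/-- A factor of a linear identity is linear: `j ≫ m = 𝟙` with `deg_Fr(m) = 1` forces `deg_Fr(j) = 1`.
[cite: MochizukiFrdII2008, Ex 3.3 (i) p.27] -/
private theorem degFr_eq_one_of_comp_eq_id {M : C0} (j : Q ⟶ M) (m : M ⟶ Q) (h : j ≫ m = 𝟙 Q)
    (hm : degFr m = 1) : degFr j = 1 := by
  have h' := congrArg degFr h
  rw [degFr_comp', degFr_id', hm, mul_one] at h'
  exact h'

/-- **Intermediate factorisation from Lemma 3.2 (vii)**: a linear isometry `ψ : P → Q` of `C₀` with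
complex codomain which is not an isomorphism and whose codomain is NOT isotropic factors through a
complex object as `ψ = m₁ ≫ m₂` with `m₁ = (id, 1, c_ψ)`, `m₂ = (Base ψ, 1, 1)` linear isometries,
NEITHER of which is an isomorphism: the angular part of the intermediate object is a connected open
lying strictly between `(c/|c|) · B_P` and the (twisted) angular part of `Q`.
[cite: MochizukiFrdII2008, Lem 3.2 (vii) p.26] -/
theorem exists_fac_of_not_isotropic (ψ : P ⟶ Q) (hQ : Q.IsComplexObj) (hdeg : degFr ψ = 1)
    (hiso : ‖(scalar ψ : ℂ)‖ * P.tip = Q.tip) (hnot : ¬ IsIso ψ) (hQi : ¬ Q.IsNaivelyIsotropic) :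
    ∃ (M : C0) (m₁ : P ⟶ M) (m₂ : M ⟶ Q), M.IsComplexObj ∧ degFr m₁ = 1 ∧ degFr m₂ = 1 ∧
      ‖(scalar m₁ : ℂ)‖ * P.tip = M.tip ∧ ‖(scalar m₂ : ℂ)‖ * M.tip = Q.tip ∧ m₁ ≫ m₂ = ψ ∧
      ¬ IsIso m₁ ∧ ¬ IsIso m₂ := by
  have hP : P.IsComplexObj := D0.eq_complex_of_hom_complex (Base ψ ≫ eqToHom hQ)
  haveI : IsIso (Base ψ) := D0.isIso_of_isComplex_target _ hQ
  -- tips in `PosReal`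
  have htip : absHom ℂ (scalar ψ) * P.region.tip = Q.region.tip := by
    apply Subtype.ext
    rw [Positive.val_mul, coe_absHom]
    exact hiso
  -- the pulled-back region of `Q` along `Base ψ`, and the direction sets
  obtain ⟨Ab, hAbc, hAbt, hAbd, -⟩ := exists_pulledRegion Q (Base ψ)
  set σ := D0.Hom.twists (Base ψ) with hσ
  -- the twist on directions is an involution
  have hff : ∀ z : normOneSubgroup ℂ,
      unitPart ℂ ((Base ψ).act ((unitPart ℂ ((Base ψ).act (z : ℂˣ)) : ℂˣ))) = z := by
    intro z
    change unitPart ℂ (D0.galAct σ ((unitPart ℂ (D0.galAct σ (z : ℂˣ)) : ℂˣ))) = z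
    rw [unitPart_galAct_coe, unitPart_galAct_coe]
    cases σ <;> simp
  have hmaps : unitPart ℂ (scalar ψ) • P.region.dir ⊆ Ab.dir ∧
      absHom ℂ (scalar ψ) * P.region.tip ≤ Ab.tip := by
    have h : scalar ψ • P.region.carrier ^ (degFr ψ : ℕ) ⊆ pullRegion Q (Base ψ) := ψ.mapsTo
    rw [hdeg, ← hAbc, show ((1 : ℕ+) : ℕ) = 0 + 1 from rfl,
      AngularRegion.smul_carrier_pow_subset_iff, zero_add, pow_one, pow_one] at h
    exact h
  have hD : unitPart ℂ (scalar ψ) • P.region.dir ⊆ Ab.dir := hmaps.1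
  -- `(c/|c|) · B_P ≠ B'`: otherwise `ψ` would be an isomorphism
  have hne : unitPart ℂ (scalar ψ) • P.region.dir ≠ Ab.dir := by
    intro heq
    apply hnot
    apply isIso_of_smul_carrier_eq ψ hdeg
    rw [← hAbc]
    exact AngularRegion.smul_carrier_eq_of_dir_eq _ _ _ heq (htip.trans hAbt.symm)
  -- `B' ≠ O_ℂ^×`: `Q` is not isotropic
  have hBu : Ab.dir ≠ Set.univ := by
    intro hu
    apply hQi
    change Q.region.dir = Set.univ
    rw [Set.eq_univ_iff_forall]
    intro z
    have hz : unitPart ℂ ((Base ψ).act (z : ℂˣ)) ∈ Ab.dir := hu ▸ Set.mem_univ _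
    rw [hAbd] at hz
    obtain ⟨w, hw, hwz⟩ := hz
    have key := congrArg (fun t : normOneSubgroup ℂ => unitPart ℂ ((Base ψ).act (t : ℂˣ))) hwz
    simp only [hff] at key
    exact key ▸ hw
  -- the intermediate angular part
  obtain ⟨C, hC, hCo, hDC, hCB, hCneD, hCneB⟩ :=
    exists_between_of_ne_of_ne_univ (isConnected_smul _ P.region.isConnected_dir)
      (isOpen_smul _ P.region.isOpen_dir) Ab.isConnected_dir Ab.isOpen_dir hD hne hBu
  obtain ⟨AC, hACd, hACt⟩ := exists_angularRegion hCo hC Q.region.tip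
  let M : C0 := ⟨P.base, AC, fun h => absurd (hP.symm.trans h) (by decide)⟩
  -- the two factors
  let m₁ : P ⟶ M :=
    { base := 𝟙 _
      degFr := 1
      scalar := scalar ψ
      scalar_mem := ψ.scalar_mem
      mapsTo := by
        change scalar ψ • P.region.carrier ^ (0 + 1) ⊆ pullRegion M (𝟙 M.base)
        rw [pullRegion_id, AngularRegion.smul_carrier_pow_subset_iff, zero_add, pow_one, pow_one, hACd,
          hACt]
        exact ⟨hDC, le_of_eq htip⟩ }
  let m₂ : M ⟶ Q :=
    { base := (Base ψ :)
      degFr := 1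
      scalar := 1
      scalar_mem := one_mem _
      mapsTo := by
        change (1 : ℂˣ) • AC.carrier ^ (0 + 1) ⊆ pullRegion Q (Base ψ)
        rw [← hAbc, AngularRegion.smul_carrier_pow_subset_iff, zero_add, pow_one, pow_one, hACd, hACt,
          unitPart_one, one_smul, map_one, one_mul, hAbt]
        exact ⟨hCB, le_rfl⟩ }
  have hfac : m₁ ≫ m₂ = ψ := by
    refine hom_ext ?_ ?_ ?_
    · rw [base_comp']
      exact Category.id_comp (Base ψ)
    · change (1 : ℕ+) * 1 = degFr ψ
      rw [hdeg]; rfl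
    · change (D0.Hom.act (𝟙 P.base)) 1 * scalar ψ ^ ((1 : ℕ+) : ℕ) = scalar ψ
      rw [map_one, one_mul, PNat.one_coe, pow_one]
  refine ⟨M, m₁, m₂, hP, rfl, rfl, ?_, ?_, hfac, ?_, ?_⟩
  · change ‖(scalar ψ : ℂ)‖ * P.tip = ((AC.tip : ℝ))
    rw [hACt]; exact hiso
  · change ‖((1 : ℂˣ) : ℂ)‖ * (AC.tip : ℝ) = Q.tip
    rw [Units.val_one, norm_one, one_mul, hACt]; rfl
  · -- `m₁` is not an isomorphism: its inverse would squeeze `C` into `(c/|c|) · B_P`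
    intro h
    have h1 : inv m₁ ≫ m₁ = 𝟙 M := IsIso.inv_hom_id m₁
    have hb : Base (inv m₁) = 𝟙 P.base := by
      have := congrArg Base h1
      rw [base_comp', base_id'] at this
      exact (Category.comp_id _).symm.trans this
    have hd : degFr (inv m₁) = 1 := degFr_eq_one_of_comp_eq_id _ _ h1 rfl
    have hs : scalar (inv m₁) = (scalar ψ)⁻¹ := by
      have := congrArg scalar h1
      rw [scalar_comp', scalar_id', hb] at this
      change (D0.Hom.act (𝟙 P.base)) (scalar ψ) * scalar (inv m₁) ^ ((1 : ℕ+) : ℕ) = 1 at this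
      rw [PNat.one_coe, pow_one] at this
      change D0.galAct (D0.Hom.twists (𝟙 P.base)) (scalar ψ) * scalar (inv m₁) = 1 at this
      rw [D0.twists_id, D0.galAct_false] at this
      exact eq_inv_of_mul_eq_one_right this
    have hmaps : scalar (inv m₁) • AC.carrier ^ (degFr (inv m₁) : ℕ) ⊆ pullRegion P (Base (inv m₁)) :=
      (inv m₁).mapsTo
    rw [hd, hs, hb, show ((1 : ℕ+) : ℕ) = 0 + 1 from rfl] at hmaps
    rw [pullRegion_id, AngularRegion.smul_carrier_pow_subset_iff, zero_add, pow_one, hACd, unitPart_inv,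
      ← Set.subset_smul_set_iff] at hmaps
    exact hCneD (le_antisymm hmaps.1 hDC)
  · -- `m₂` is not an isomorphism: its inverse would squeeze `B'` into `C`
    intro h
    have h1 : inv m₂ ≫ m₂ = 𝟙 Q := IsIso.inv_hom_id m₂
    have hb : Base (inv m₂) ≫ (Base ψ :) = 𝟙 Q.base := by
      have := congrArg Base h1
      rwa [base_comp', base_id'] at this
    have hbinv : Base (inv m₂) = inv (Base ψ :) := IsIso.eq_inv_of_inv_hom_id hb
    have htw : D0.Hom.twists (Base (inv m₂)) = σ := by rw [hbinv, D0.twists_inv]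
    have hd : degFr (inv m₂) = 1 := degFr_eq_one_of_comp_eq_id _ _ h1 rfl
    have hs : scalar (inv m₂) = 1 := by
      have := congrArg scalar h1
      rw [scalar_comp', scalar_id'] at this
      change (Base (inv m₂)).act 1 * scalar (inv m₂) ^ ((1 : ℕ+) : ℕ) = 1 at this
      rwa [map_one, one_mul, PNat.one_coe, pow_one] at this
    obtain ⟨Aj, hAjc, -, hAjd, -⟩ := exists_pulledRegion M (Base (inv m₂))
    have hmaps : scalar (inv m₂) • Q.region.carrier ^ (degFr (inv m₂) : ℕ) ⊆
        pullRegion M (Base (inv m₂)) := (inv m₂).mapsTo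
    rw [hd, hs, ← hAjc, show ((1 : ℕ+) : ℕ) = 0 + 1 from rfl, AngularRegion.smul_carrier_pow_subset_iff,
      zero_add, pow_one, unitPart_one, one_smul, hAjd] at hmaps
    -- `B_Q ⊆ f(C)`, hence `B' = f(B_Q) ⊆ f(f(C)) = C`
    have hsub : Ab.dir ⊆ C := by
      rw [hAbd]
      rintro _ ⟨z, hz, rfl⟩
      obtain ⟨w, hw, hwz⟩ := hmaps.1 hz
      change w ∈ AC.dir at hw
      rw [hACd] at hw
      have hw' : unitPart ℂ (D0.galAct (D0.Hom.twists (Base (inv m₂))) (w : ℂˣ)) = z := hwz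
      rw [htw] at hw'
      have : unitPart ℂ ((Base ψ).act (z : ℂˣ)) = w := by
        rw [← hw']
        exact hff w
      show unitPart ℂ ((Base ψ).act (z : ℂˣ)) ∈ C
      rw [this]
      exact hw
    exact hCneB (le_antisymm hCB hsub)

end C0

/-! ### Irreducible arrows of `R₀` out of a complex object -/

namespace R0

/-- The underlying `C₀`-arrow of an arrow of `R₀` is a linear isometry (unpacked).
[cite: MochizukiFrdII2008, Ex 3.3 (iv) p.29] -/
theorem carrier_data {X Y : R0} (k : X ⟶ Y) :
    C0.degFr (N0.homCarrier k.left) = 1 ∧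
      ‖(C0.scalar (N0.homCarrier k.left) : ℂ)‖ * X.left.carrier.tip = Y.left.carrier.tip := by
  have hdeg : C0.degFr (N0.homCarrier k.left) = 1 := k.left.property
  have hiso := (A0.isIsometry_iff_norm_mul_tip_pow (N0.homCarrier k.left)).mp k.left.hom.property
  rw [hdeg, PNat.one_coe, pow_one] at hiso
  exact ⟨hdeg, hiso⟩

/-- An arrow of `R₀` whose underlying `C₀`-arrow is invertible is invertible (local copy of
`R0.isIso_of_isIso_carrier` of `ArchimedeanFSMFFPiecesR.lean`, kept private to keep the imports light).
[cite: MochizukiFrdII2008, Ex 3.3 (iv) p.29] -/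
private theorem isIso_of_isIso_homCarrier_left' {X Y : R0} (k : X ⟶ Y) [IsIso (N0.homCarrier k.left)] :
    IsIso k := by
  haveI : IsIso k.left := N0.isIso_of_isIso_carrier k.left
  haveI : IsIso ((Over.forget N0.realUnit).map k) := by
    change IsIso k.left; infer_instance
  exact isIso_of_reflects_iso k (Over.forget N0.realUnit)

/-- Lifting a factorisation of the underlying `C₀`-arrow into linear isometries to a factorisation
in `R₀` (the intermediate object is rigidified through the second factor).
[cite: MochizukiFrdII2008, Ex 3.3 (iv) p.29] -/
theorem exists_fac_of_fac {X Y : R0} (k : X ⟶ Y) {M : C0} (m₁ : X.left.carrier ⟶ M)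
    (m₂ : M ⟶ Y.left.carrier) (h₁ : PreFrobenioid.IsIsometry C0.toElem m₁) (hd₁ : C0.degFr m₁ = 1)
    (h₂ : PreFrobenioid.IsIsometry C0.toElem m₂) (hd₂ : C0.degFr m₂ = 1)
    (hfac : m₁ ≫ m₂ = N0.homCarrier k.left) :
    ∃ (MR : R0) (r₁ : X ⟶ MR) (r₂ : MR ⟶ Y), r₁ ≫ r₂ = k ∧
      (IsIso r₁ → IsIso m₁) ∧ (IsIso r₂ → IsIso m₂) := by
  let n₁ : X.left ⟶ (⟨⟨M⟩⟩ : N0) := N0.homMk m₁ h₁ hd₁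
  let n₂ : (⟨⟨M⟩⟩ : N0) ⟶ Y.left := N0.homMk m₂ h₂ hd₂
  have hn : n₁ ≫ n₂ = k.left := N0.hom_ext (by rw [N0.homCarrier_comp]; exact hfac)
  let MR : R0 := Over.mk (n₂ ≫ Y.hom)
  let r₁ : X ⟶ MR := Over.homMk n₁ (show n₁ ≫ n₂ ≫ Y.hom = X.hom by
    rw [← Category.assoc, hn]; exact Over.w k)
  let r₂ : MR ⟶ Y := Over.homMk n₂ rfl
  refine ⟨MR, r₁, r₂, ?_, fun h => ?_, fun h => ?_⟩
  · exact Over.OverMorphism.ext (by rw [Over.comp_left]; change n₁ ≫ n₂ = k.left; exact hn)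
  · change IsIso ((Over.forget N0.realUnit ⋙ N0.toC0).map r₁)
    infer_instance
  · change IsIso ((Over.forget N0.realUnit ⋙ N0.toC0).map r₂)
    infer_instance

/-- **An irreducible arrow of `R₀` with complex codomain has (naively) ISOTROPIC codomain**: otherwise
the factorisation of `C0.exists_fac_of_not_isotropic` (Lemma 3.2 (vii)) lifts to `R₀` with neither
factor invertible. (So the irreducible arrows in question are the slit morphisms, Ex. 3.3 (v).)
[cite: MochizukiFrdII2008, Prop 3.5 (iii) p.34] -/
theorem isNaivelyIsotropic_of_irreducible {X Y : R0} (k : X ⟶ Y) (hk : IsIrreducibleHom k)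
    (hY : (R0.toD0.obj Y).IsComplex) : Y.left.carrier.IsNaivelyIsotropic := by
  by_contra hYi
  obtain ⟨hdeg, hiso⟩ := carrier_data k
  have hnot : ¬ IsIso (N0.homCarrier k.left) := by
    intro h
    exact hk.1 (isIso_of_isIso_homCarrier_left' k)
  obtain ⟨M, m₁, m₂, -, hd₁, hd₂, hi₁, hi₂, hfac, hm₁, hm₂⟩ :=
    C0.exists_fac_of_not_isotropic (N0.homCarrier k.left) hY hdeg hiso hnot hYi
  have h₁ : PreFrobenioid.IsIsometry C0.toElem m₁ :=
    (A0.isIsometry_iff_norm_mul_tip_pow m₁).mpr (by rw [hd₁, PNat.one_coe, pow_one]; exact hi₁)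
  have h₂ : PreFrobenioid.IsIsometry C0.toElem m₂ :=
    (A0.isIsometry_iff_norm_mul_tip_pow m₂).mpr (by rw [hd₂, PNat.one_coe, pow_one]; exact hi₂)
  obtain ⟨MR, r₁, r₂, hr, hr₁, hr₂⟩ := exists_fac_of_fac k m₁ m₂ h₁ hd₁ h₂ hd₂ hfac
  rcases hk.2 r₁ r₂ hr with h | h
  · exact hm₂ (hr₂ h)
  · exact hm₁ (hr₁ h)

/-- **Any two arrows of `R₀` from the same object to complex ISOTROPIC objects are isomorphic under it**:
the comparison arrow `(Base κ⁻¹ ≫ Base κ', 1, Base κ (c'/c))` is an isomorphism of `C₀`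
(`C0.isIso_of_isIsotropic`), hence of `N₀`, and it respects the rigidifications because arrows of `N₀`
are epimorphisms. [cite: MochizukiFrdII2008, Prop 3.5 (iii) p.34] -/
theorem exists_iso_of_isotropic {X Y Y' : R0} (k : X ⟶ Y) (k' : X ⟶ Y') (hY : (R0.toD0.obj Y).IsComplex)
    (hY' : (R0.toD0.obj Y').IsComplex) (hYi : Y.left.carrier.IsNaivelyIsotropic)
    (hY'i : Y'.left.carrier.IsNaivelyIsotropic) : ∃ t : Y ≅ Y', k ≫ t.hom = k' := by
  obtain ⟨hdeg, hiso⟩ := carrier_data k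
  obtain ⟨hdeg', hiso'⟩ := carrier_data k'
  set κ := N0.homCarrier k.left with hκ
  set κ' := N0.homCarrier k'.left with hκ'
  haveI : IsIso (C0.Base κ) := D0.isIso_of_isComplex_target _ hY
  haveI : IsIso (C0.Base κ') := D0.isIso_of_isComplex_target _ hY'
  have hc : 0 < ‖(C0.scalar κ : ℂ)‖ := norm_pos_iff.mpr (C0.scalar κ).ne_zero
  have htip : absHom ℂ (C0.scalar κ) * X.left.carrier.region.tip = Y.left.carrier.region.tip := by
    apply Subtype.ext; rw [Positive.val_mul, coe_absHom]; exact hiso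
  have htip' : absHom ℂ (C0.scalar κ') * X.left.carrier.region.tip = Y'.left.carrier.region.tip := by
    apply Subtype.ext; rw [Positive.val_mul, coe_absHom]; exact hiso'
  -- the comparison arrow of `C₀`
  obtain ⟨A', hA'c, hA't, -, hA'i⟩ := exists_pulledRegion Y'.left.carrier (inv (C0.Base κ) ≫ C0.Base κ')
  let tc : Y.left.carrier ⟶ Y'.left.carrier :=
    { base := inv (C0.Base κ) ≫ C0.Base κ'
      degFr := 1
      scalar := (C0.Base κ).act (C0.scalar κ' * (C0.scalar κ)⁻¹)
      scalar_mem := by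
        have hsc : D0.scalars Y.left.carrier.base = ⊤ := by
          rw [show Y.left.carrier.base = D0.complex from hY]; exact D0.scalars_complex
        rw [hsc]
        exact Subgroup.mem_top _
      mapsTo := by
        change (C0.Base κ).act (C0.scalar κ' * (C0.scalar κ)⁻¹) • Y.left.carrier.region.carrier ^ (0 + 1) ⊆
          C0.pullRegion Y'.left.carrier (inv (C0.Base κ) ≫ C0.Base κ')
        rw [← hA'c, AngularRegion.smul_carrier_pow_subset_iff, zero_add, pow_one, pow_one,
          show A'.dir = Set.univ from hA'i hY'i, hA't]
        refine ⟨Set.subset_univ _, le_of_eq ?_⟩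
        rw [C0.absHom_galAct, map_mul, map_inv, ← htip', ← htip, mul_assoc, inv_mul_cancel_left] }
  have hcomp : κ ≫ tc = κ' := by
    refine C0.hom_ext ?_ ?_ ?_
    · rw [C0.base_comp']
      exact IsIso.hom_inv_id_assoc _ _
    · rw [C0.degFr_comp', hdeg, hdeg']; rfl
    · rw [C0.scalar_comp']
      change (C0.Base κ).act ((C0.Base κ).act (C0.scalar κ' * (C0.scalar κ)⁻¹)) *
        C0.scalar κ ^ ((1 : ℕ+) : ℕ) = C0.scalar κ'
      change D0.galAct _ (D0.galAct _ _) * _ = _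
      rw [D0.galAct_galAct, PNat.one_coe, pow_one, inv_mul_cancel_right]
  have htciso : ‖(C0.scalar tc : ℂ)‖ * Y.left.carrier.tip ^ (C0.degFr tc : ℕ) = Y'.left.carrier.tip := by
    change ‖((D0.galAct _ (C0.scalar κ' * (C0.scalar κ)⁻¹) : ℂˣ) : ℂ)‖ * Y.left.carrier.tip ^ ((1 : ℕ+) : ℕ) = _
    rw [D0.norm_galAct, PNat.one_coe, pow_one, Units.val_mul, norm_mul, Units.val_inv_eq_inv_val,
      norm_inv, ← hiso, ← hiso']
    field_simp
  haveI : IsIso tc := C0.isIso_of_isIsotropic tc hYi rfl htciso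
  let tn : Y.left ⟶ Y'.left := N0.homMk tc ((A0.isIsometry_iff_norm_mul_tip_pow tc).mpr htciso) rfl
  haveI : IsIso (N0.homCarrier tn) := by change IsIso tc; infer_instance
  haveI : IsIso tn := N0.isIso_of_isIso_carrier tn
  have hkt : k.left ≫ tn = k'.left := N0.hom_ext (by rw [N0.homCarrier_comp]; exact hcomp)
  haveI : Epi k.left := N0.isTotallyEpimorphic'.epi k.left
  have hw : (asIso tn).hom ≫ Y'.hom = Y.hom := by
    rw [asIso_hom, ← cancel_epi k.left, ← Category.assoc, hkt, Over.w k, Over.w k']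
  refine ⟨Over.isoMk (asIso tn) hw, Over.OverMorphism.ext ?_⟩
  rw [Over.comp_left]
  change k.left ≫ tn = k'.left
  exact hkt

/-- **Any two IRREDUCIBLE arrows of `R₀` out of the same object with complex codomains are isomorphic
under it** — the input `hB` of the anchor transfer `R.isRCAnchor_of_isRCAnchor_snd`.
[cite: MochizukiFrdII2008, Prop 3.5 (iii) p.34] -/
theorem exists_iso_of_irreducible {X Y Y' : R0} (k : X ⟶ Y) (k' : X ⟶ Y') (hk : IsIrreducibleHom k)
    (hk' : IsIrreducibleHom k') (hY : (R0.toD0.obj Y).IsComplex) (hY' : (R0.toD0.obj Y').IsComplex) :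
    ∃ t : Y ≅ Y', k ≫ t.hom = k' :=
  exists_iso_of_isotropic k k' hY hY' (isNaivelyIsotropic_of_irreducible k hk hY)
    (isNaivelyIsotropic_of_irreducible k' hk' hY')

end R0

/-! ### The anchor transfer for `R`, unconditionally -/

/-- **An object of `R = R₀ ×_{D₀} D` lying over an RC-anchor of `D` is an RC-anchor of `R`**, for every
base `π : D → D₀` ([FrdII] proof of Prop. 3.5 (iii), p. 35 ll. 28–40: "it suffices to show that `C` is an
anchor of `G[ℂ]` …"). [cite: MochizukiFrdII2008, Prop 3.5 (iii) p.34] -/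
theorem R.isRCAnchor_of_isRCAnchor_base {D : Type u} [Category.{v} D] (π : D ⥤ D0) (X : R π)
    (hX : RC.IsRCAnchor (baseRC π) X.snd) :
    RC.IsRCAnchor (R.toC π ⋙ PreFrobenioid.baseFunctor (C.toElem π) ⋙ baseRC π) X :=
  R.isRCAnchor_of_isRCAnchor_snd π X hX fun _ _ k k' hk hk' hY hY' =>
    R0.exists_iso_of_irreducible k k' hk hk' hY hY'

end ArchFrd

end

end Literature.AlgebraicGeometry.Frobenioids
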